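import Literature.AlgebraicTopology.SingularHomology.FiniteQuotientInvariants
import Literature.AlgebraicTopology.SingularHomology.SubsetCochainsComparisonPull
import Literature.AlgebraicTopology.SingularHomology.SubsetCohomologyMayerVietoris
import Mathlib.Topology.Covering.Quotient
import HarnessLib

/-!
# Orbit maps of finite group actions: the action on the cohomology of preimages, averaging, and
# the free part as a finite regular covering (towards Bredon, *Sheaf Theory* II.19.2)

Topic `Literature/AlgebraicTopology/SingularHomology`. First of three files proving the special
case "semi-free actions with taut fixed locus" of the tree's named fact
`bredon1997_quotient_cohomology_invariants` (Bredon II Thm. 19.2: the cohomology of a finite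
quotient is the invariant cohomology) — see `SemiFreeQuotientTransfer.lean` for the statement and
the strategy (Mayer–Vietoris over shrinking neighbourhoods of the branch locus, tautness instead
of tubular neighbourhoods, the free case off the branch locus). Here, for a finite group `G`
acting continuously on `Z` and a continuous `q : Z → Y` whose fibres are the `G`-orbits:

* §0 complements on the cohomology `H^p_X(A)` of subsets computed in `C(X)` (`subsetCochains`):
  elementwise functoriality of restriction and pull-back, and injectivity of the Mayer–Vietoris
  restriction `H⁰_X(A ∪ B) → H⁰_X(A) ⊞ H⁰_X(B)` in degree `0`;
* §1 `OrbitMap.act g` — the action of `g` on `H^p_Z(q⁻¹S)`; `OrbitMap.qH` — the pull-back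
  `q^* : H^p_Y(S) → H^p_Z(q⁻¹S)`, landing in the invariants (`act_qH`); compatibility with
  restriction; the averaging operator `OrbitMap.avg` (`|G|` invertible);
* §2 `OrbitMap.freeCover` — for `O ⊆ Y` over which the action is free, `q⁻¹O → O` is a finite
  regular covering with deck group `G` (Mathlib's
  `IsQuotientMap.isCoveringMapOn_of_properlyDiscontinuousSMul`; Hatcher Prop. 1.40), whence the
  FREE CASE in the subset model: `qH_injective_of_free`, `exists_qH_eq_of_free` (from the tree's
  `FiniteDeckCover.map_proj_injective` / `mem_range_map_proj_of_invariant`, transported along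
  `H^p_X(W) ≅ H^p(↥W)`, `homologyIsoSingularCohomology_hom_pullH`).

Everything is proved; no named facts, no instances (the action on `↥(q⁻¹S)` is a `def` used as a
local instance inside proofs).

## References

* [Bredon1997] G. E. Bredon, *Sheaf Theory*, 2nd ed., GTM 170 (1997), II §19, Thm. 19.1–19.2.
* [HatcherAT2002] A. Hatcher, *Algebraic Topology*, CUP 2002, §1.3 Prop. 1.40, §3.1 pp. 199–204,
  §3.G Prop. 3G.1.
-/

noncomputable section

-- as in `SubsetCochainsComparisonPull`: chains of the concrete complex are `Finsupp`s up to unfolding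
set_option backward.isDefEq.respectTransparency false

open CategoryTheory Limits Set Function
open _root_.Topology

universe u v w

namespace Literature.AlgebraicTopology.SingularHomology

/-! ### §0 Complements on the cohomology of subsets computed in `C(X)` -/

namespace subsetCochains

variable {R : Type v} [CommRing R] {N : ModuleCat.{max u v} R} {X X' : Type u} [TopologicalSpace X]
  [TopologicalSpace X']

/-- Restrictions compose, elementwise. [cite: HatcherAT2002, §3.1 p. 199] -/
theorem resH_resH {A B C : Set X} (h : A ⊆ B) (h' : B ⊆ C) (p : ℕ) (x : (subsetCochains R N C).homology p) :
    resH h p (resH h' p x) = resH (h.trans h') p x := by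
  rw [← ModuleCat.comp_apply, ← HomologicalComplex.homologyMap_comp, ← res_comp]

/-- Restriction along `A ⊆ A` is the identity, elementwise. [cite: HatcherAT2002, §3.1 p. 199] -/
theorem resH_rfl {A : Set X} (h : A ⊆ A) (p : ℕ) (x : (subsetCochains R N A).homology p) :
    resH h p x = x := by
  have e : res R N h = 𝟙 _ := res_refl A
  change HomologicalComplex.homologyMap (res R N h) p x = x
  rw [e, HomologicalComplex.homologyMap_id, ModuleCat.id_apply]

/-- Restriction between two equal subsets is injective (its inverse is the opposite restriction).
[cite: HatcherAT2002, §3.1 p. 199] -/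
theorem resH_injective_of_subset {A B : Set X} (h : A ⊆ B) (h' : B ⊆ A) (p : ℕ) :
    Function.Injective (resH (N := N) h p) := by
  intro x y hxy
  rw [← resH_rfl (h'.trans h) p x, ← resH_rfl (h'.trans h) p y, ← resH_resH h' h, ← resH_resH h' h, hxy]

/-- Pull-backs along equal continuous maps agree (the `MapsTo` witnesses are propositions).
[cite: HatcherAT2002, §3.1 p. 199] -/
theorem pullH_congr {f f' : C(X, X')} (e : f = f') {U : Set X} {V : Set X'} (h : Set.MapsTo f U V)
    (h' : Set.MapsTo f' U V) (p : ℕ) (y : (subsetCochains R N V).homology p) :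
    pullH (N := N) f h p y = pullH (N := N) f' h' p y := by
  subst e
  rfl

/-- A pull-back into `U` is the pull-back into the full preimage followed by restriction.
[cite: HatcherAT2002, §3.1 p. 199] -/
theorem pullH_eq_resH_pullH (f : C(X, X')) {U : Set X} {V : Set X'} (h : Set.MapsTo f U V)
    (hU : U ⊆ f ⁻¹' V) (p : ℕ) (y : (subsetCochains R N V).homology p) :
    pullH (N := N) f h p y = resH hU p (pullH (N := N) f (mapsTo_preimage f V) p y) := by
  have e := resH_comp_pullH (N := N) f hU (subset_refl V) (mapsTo_preimage f V) h p
  have e' := congrArg (fun φ ↦ φ y) e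
  simp only [ModuleCat.comp_apply] at e'
  rw [resH_rfl] at e'
  exact e'

/-- Elementwise form of `resH_comp_pullH`: restriction commutes with pull-back. [cite: HatcherAT2002, §3.1 p. 199] -/
theorem resH_pullH (f : C(X, X')) {U U' : Set X} {V V' : Set X'} (hU : U' ⊆ U) (hV : V' ⊆ V)
    (h : Set.MapsTo f U V) (h' : Set.MapsTo f U' V') (p : ℕ) (y : (subsetCochains R N V).homology p) :
    resH hU p (pullH (N := N) f h p y) = pullH (N := N) f h' p (resH hV p y) := by
  have e := congrArg (fun φ ↦ φ y) (resH_comp_pullH (N := N) f hU hV h h' p)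
  simp only [ModuleCat.comp_apply] at e
  exact e.symm

/-- **In degree `0` the Mayer–Vietoris restriction `H⁰_X(A ∪ B) → H⁰_X(A) ⊞ H⁰_X(B)` is injective**
(the long exact sequence starts with `0 → H⁰(A ∪ B)`; Hatcher 2002, §3.1 p. 203).
[cite: HatcherAT2002, §3.1 p. 203] -/
theorem mvRes_zero_injective {A B : Set X} (hA : IsOpen A) (hB : IsOpen B) :
    Function.Injective (mvRes R N A B 0) := by
  have hS := mvShortComplex_shortExact R N A B
  haveI : Mono (mvShortComplex R N A B).f := hS.mono_f
  haveI : Mono (HomologicalComplex.homologyMap (mvShortComplex R N A B).f 0) :=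
    HomologicalComplex.mono_homologyMap_of_mono_of_not_rel _ 0 (fun i h ↦ Nat.succ_ne_zero i h)
  haveI : Mono ((supHomologyIso (N := N) hA hB 0).hom ≫ mvRes R N A B 0) := by
    rw [supHomologyIso_hom_comp_mvRes hA hB 0]
    exact mono_comp _ _
  have e : mvRes R N A B 0 =
      (supHomologyIso (N := N) hA hB 0).inv ≫ ((supHomologyIso (N := N) hA hB 0).hom ≫ mvRes R N A B 0) := by
    rw [Iso.inv_hom_id_assoc]
  haveI : Mono (mvRes R N A B 0) := by
    rw [e]
    exact mono_comp _ _
  exact (ModuleCat.mono_iff_injective _).1 inferInstance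

/-- `mvRes` is injective on classes vanishing on both pieces, in every degree `p`: a class on
`A ∪ B` restricting to `0` on `A` and on `B` is `0` as soon as it is `δ` of something killed —
packaged as: `mvRes c = 0 → (p = 0 → c = 0)`. [cite: HatcherAT2002, §3.1 p. 199] -/
theorem eq_zero_of_mvRes_eq_zero_of_eq_zero {A B : Set X} (hA : IsOpen A) (hB : IsOpen B)
    (c : (subsetCochains R N (A ∪ B)).homology 0) (h : mvRes R N A B 0 c = 0) : c = 0 :=
  mvRes_zero_injective hA hB (h.trans (map_zero _).symm)

end subsetCochains

/-! ### §1 The orbit map: the action on the cohomology of preimages, pull-back, averaging -/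

namespace OrbitMap

open subsetCochains

variable {R : Type v} [Field R]

variable {G : Type w} [Group G] {Z Y : Type u} [TopologicalSpace Z] [TopologicalSpace Y]
  [MulAction G Z] [ContinuousConstSMul G Z] (q : C(Z, Y))
  (horb : ∀ z z' : Z, q z = q z' ↔ ∃ g : G, g • z = z')

/-- The action of `g` on `Z` as a continuous map. [cite: Bredon1997, II §19] -/
def smulMap (g : G) : C(Z, Z) := ⟨fun z ↦ g • z, continuous_const_smul g⟩

/-- `smulMap g z = g • z`. [cite: Bredon1997, II §19 Thm. 19.1] -/
@[simp] theorem smulMap_apply (g : G) (z : Z) : smulMap (Z := Z) g z = g • z := rfl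

/-- `smulMap g ∘ smulMap h = smulMap (g * h)`. [cite: Bredon1997, II §19 Thm. 19.1] -/
theorem smulMap_comp (g h : G) : (smulMap (Z := Z) g).comp (smulMap h) = smulMap (g * h) := by
  ext z
  exact (mul_smul g h z).symm

omit [ContinuousConstSMul G Z] in
include horb in
/-- The orbit map is constant on orbits: `q (g • z) = q z`. [cite: Bredon1997, II §19] -/
theorem apply_smul (g : G) (z : Z) : q (g • z) = q z :=
  ((horb z (g • z)).2 ⟨g, rfl⟩).symm

include horb in
/-- `q ∘ (g • –) = q`. [cite: Bredon1997, II §19 Thm. 19.1] -/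
theorem comp_smulMap (g : G) : q.comp (smulMap g) = q :=
  ContinuousMap.ext fun z ↦ apply_smul q horb g z

include horb in
/-- `g` maps `q⁻¹S` into `q⁻¹S`. [cite: Bredon1997, II §19 Thm. 19.1] -/
theorem mapsTo_smul (g : G) (S : Set Y) : Set.MapsTo (smulMap g) (q ⁻¹' S) (q ⁻¹' S) := by
  intro z hz
  change q (g • z) ∈ S
  rw [apply_smul q horb]
  exact hz

variable (S : Set Y)

/-- **The action of `g ∈ G` on `H^p_Z(q⁻¹S)`** (pull-back along `z ↦ g • z`, which preserves
`q⁻¹S`). [cite: Bredon1997, II §19] -/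
def act (g : G) (p : ℕ) :
    (subsetCochains R (SimplexSpan.coefR R) (q ⁻¹' S)).homology p ⟶ (subsetCochains R (SimplexSpan.coefR R) (q ⁻¹' S)).homology p :=
  pullH (N := SimplexSpan.coefR R) (smulMap g) (mapsTo_smul q horb g S) p

/-- **The pull-back `q^* : H^p_Y(S) → H^p_Z(q⁻¹S)`.** [cite: Bredon1997, II §19] -/
abbrev qH (p : ℕ) :
    (subsetCochains R (SimplexSpan.coefR R) S).homology p ⟶ (subsetCochains R (SimplexSpan.coefR R) (q ⁻¹' S)).homology p :=
  pullH (N := SimplexSpan.coefR R) q (mapsTo_preimage q S) p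

variable {S}

/-- `act h (act g x) = act (g * h) x` (contravariance of pull-back). [cite: Bredon1997, II §19 Thm. 19.1] -/
theorem act_act (g h : G) (p : ℕ) (x : (subsetCochains R (SimplexSpan.coefR R) (q ⁻¹' S)).homology p) :
    act q horb S h p (act q horb S g p x) = act q horb S (g * h) p x := by
  unfold act
  rw [pullH_pullH (smulMap h) (smulMap g) (mapsTo_smul q horb h S) (mapsTo_smul q horb g S)
    ((mapsTo_smul q horb g S).comp (mapsTo_smul q horb h S))]
  exact pullH_congr (smulMap_comp g h) _ _ p x

/-- **`q^*` lands in the invariants: `act g (q^* y) = q^* y`** (`q ∘ g = q`).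
[cite: Bredon1997, II §19 before Thm. 19.2] -/
theorem act_qH (g : G) (p : ℕ) (y : (subsetCochains R (SimplexSpan.coefR R) S).homology p) :
    act q horb S g p (qH (R := R) q S p y) = qH (R := R) q S p y := by
  unfold act qH
  rw [pullH_pullH (smulMap g) q (mapsTo_smul q horb g S) (mapsTo_preimage q S)
    ((mapsTo_preimage q S).comp (mapsTo_smul q horb g S))]
  exact pullH_congr (comp_smulMap q horb g) _ _ p y

/-- Restriction `H_Z(q⁻¹S) → H_Z(q⁻¹S')` commutes with the action (`S' ⊆ S`). [cite: Bredon1997, II §19 Thm. 19.1] -/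
theorem resH_act {S' : Set Y} (hS : S' ⊆ S) (g : G) (p : ℕ)
    (x : (subsetCochains R (SimplexSpan.coefR R) (q ⁻¹' S)).homology p) :
    resH (preimage_mono hS) p (act q horb S g p x) = act q horb S' g p (resH (preimage_mono hS) p x) :=
  resH_pullH _ _ _ _ _ p x

/-- Restriction commutes with `q^*`. [cite: Bredon1997, II §19 Thm. 19.1] -/
theorem resH_qH {S' : Set Y} (hS : S' ⊆ S) (p : ℕ) (y : (subsetCochains R (SimplexSpan.coefR R) S).homology p) :
    resH (preimage_mono hS) p (qH (R := R) q S p y) = qH (R := R) q S' p (resH hS p y) :=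
  resH_pullH _ _ _ _ _ p y

section Average

variable [Fintype G] (hG : IsUnit (Fintype.card G : R))

/-- **Averaging over `G`**: `avg x = |G|⁻¹ Σ_g g^* x`. [cite: Bredon1997, II Thm. 19.1 (μ^* π^* = ord G)] -/
def avg (p : ℕ) (x : (subsetCochains R (SimplexSpan.coefR R) (q ⁻¹' S)).homology p) :
    (subsetCochains R (SimplexSpan.coefR R) (q ⁻¹' S)).homology p :=
  ((hG.unit⁻¹ : Rˣ) : R) • ∑ g : G, act q horb S g p x

/-- The average is invariant. [cite: Bredon1997, II §19 Thm. 19.1] -/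
theorem act_avg (h : G) (p : ℕ) (x : (subsetCochains R (SimplexSpan.coefR R) (q ⁻¹' S)).homology p) :
    act q horb S h p (avg q horb hG p x) = avg q horb hG p x := by
  unfold avg
  rw [map_smul, map_sum]
  congr 1
  have e : ∀ g : G, act q horb S h p (act q horb S g p x) = act q horb S (g * h) p x :=
    fun g ↦ act_act q horb g h p x
  simp only [e]
  exact Fintype.sum_equiv (Equiv.mulRight h) _ _ fun g ↦ rfl

/-- An invariant class is its own average. [cite: Bredon1997, II §19 Thm. 19.1] -/
theorem avg_eq_self (p : ℕ) (x : (subsetCochains R (SimplexSpan.coefR R) (q ⁻¹' S)).homology p)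
    (hx : ∀ g : G, act q horb S g p x = x) : avg q horb hG p x = x := by
  unfold avg
  simp only [hx, Finset.sum_const, Finset.card_univ]
  rw [← Nat.cast_smul_eq_nsmul R, smul_smul, IsUnit.val_inv_mul, one_smul]

/-- Averaging commutes with restriction. [cite: Bredon1997, II §19 Thm. 19.1] -/
theorem resH_avg {S' : Set Y} (hS : S' ⊆ S) (p : ℕ) (x : (subsetCochains R (SimplexSpan.coefR R) (q ⁻¹' S)).homology p) :
    resH (preimage_mono hS) p (avg q horb hG p x) = avg q horb (S := S') hG p (resH (preimage_mono hS) p x) := by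
  unfold avg
  rw [map_smul, map_sum]
  congr 1
  exact Finset.sum_congr rfl fun g _ ↦ resH_act q horb hS g p x

/-- Averaging commutes with any family of equivariant additive maps. [cite: Bredon1997, II §19 Thm. 19.1] -/
theorem map_avg {S' : Set Y} {p p' : ℕ}
    (φ : (subsetCochains R (SimplexSpan.coefR R) (q ⁻¹' S)).homology p ⟶ (subsetCochains R (SimplexSpan.coefR R) (q ⁻¹' S')).homology p')
    (hφ : ∀ (g : G) x, φ (act q horb S g p x) = act q horb S' g p' (φ x))
    (x : (subsetCochains R (SimplexSpan.coefR R) (q ⁻¹' S)).homology p) :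
    φ (avg q horb hG p x) = avg q horb (S := S') hG p' (φ x) := by
  unfold avg
  rw [map_smul, map_sum]
  congr 1
  exact Finset.sum_congr rfl fun g _ ↦ hφ g x

/-- Averaging is additive: `avg (x - y) = avg x - avg y`. [cite: Bredon1997, II §19 Thm. 19.1] -/
theorem avg_sub (p : ℕ) (x y : (subsetCochains R (SimplexSpan.coefR R) (q ⁻¹' S)).homology p) :
    avg q horb hG p (x - y) = avg q horb hG p x - avg q horb hG p y := by
  unfold avg
  simp only [map_sub, Finset.sum_sub_distrib, smul_sub]

end Average

/-! ### §2 The free part: `q⁻¹O → O` is a finite regular covering off the branch locus -/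

section Free

variable [CompactSpace Z] [T2Space Z] [T2Space Y] (hsurj : Function.Surjective q)

/-- The action of `G` on the subspace `q⁻¹S` (a `def`, used as a local instance inside proofs
only). [cite: HatcherAT2002, §1.3 Prop. 1.40] -/
@[reducible]
def preimageMulAction (S : Set Y) : MulAction G ↥(q ⁻¹' S) where
  smul g z := ⟨g • (z : Z), mapsTo_smul q horb g S z.2⟩
  one_smul z := Subtype.ext (one_smul G (z : Z))
  mul_smul g h z := Subtype.ext (mul_smul g h (z : Z))

omit [MulAction G Z] [ContinuousConstSMul G Z] [T2Space Z] in
include hsurj in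
/-- **The orbit map of a compact Hausdorff `G`-space onto a Hausdorff space is a quotient map**
(it is a closed continuous surjection). [cite: HatcherAT2002, §1.3 Prop. 1.40] -/
theorem isQuotientMap : IsQuotientMap q :=
  q.continuous.isClosedMap.isQuotientMap q.continuous hsurj

include horb hsurj in
/-- **Off the non-free points `q` is a covering map** (Mathlib: the quotient map of a properly
discontinuous action — every action of a finite group — is a covering on the image of the free
locus; Hatcher Prop. 1.40). [cite: HatcherAT2002, §1.3 Prop. 1.40] -/
theorem isCoveringMapOn_free [Finite G] :
    IsCoveringMapOn q (q '' {z : Z | MulAction.stabilizer G z = ⊥}) :=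
  (isQuotientMap q hsurj).isCoveringMapOn_of_properlyDiscontinuousSMul (G := G)
    (fun {z₁ z₂} ↦ by
      rw [MulAction.mem_orbit_symm, MulAction.mem_orbit_iff]
      exact horb z₁ z₂)

omit [TopologicalSpace Z] [ContinuousConstSMul G Z] [CompactSpace Z] [T2Space Z] [T2Space Y] in
/-- A point all of whose stabilising elements are trivial has trivial stabiliser. [cite: HatcherAT2002, §1.3 Prop. 1.40] -/
theorem stabilizer_eq_bot_of {z : Z} (hz : ∀ g : G, g • z = z → g = 1) :
    MulAction.stabilizer G z = ⊥ :=
  (Subgroup.eq_bot_iff_forall _).2 fun g hg ↦ hz g (MulAction.mem_stabilizer_iff.1 hg)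

/-- **`q⁻¹O → O` as a finite regular covering with deck group `G`**, for `O ⊆ Y` over which the
action is free (Hatcher Prop. 1.40: the orbit map of a free action of a finite group on a
Hausdorff space is a normal covering). [cite: HatcherAT2002, §1.3 Prop. 1.40] -/
def freeCover [Fintype G] (O : Set Y) (hO : ∀ z : Z, q z ∈ O → ∀ g : G, g • z = z → g = 1) :
    letI := preimageMulAction q horb O
    FiniteDeckCover G ↥(q ⁻¹' O) ↥O :=
  letI := preimageMulAction q horb O
  { proj := restrictMap q (mapsTo_preimage q O)
    isCoveringMap_proj :=
      ((isCoveringMapOn_free q horb hsurj).mono (fun y hy ↦ by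
        obtain ⟨z, rfl⟩ := hsurj y
        exact ⟨z, stabilizer_eq_bot_of (hO z hy), rfl⟩)).isCoveringMap_restrictPreimage
    surjective_proj := fun y ↦ by
      obtain ⟨z, hz⟩ := hsurj y
      exact ⟨⟨z, show q z ∈ O from hz ▸ y.2⟩, Subtype.ext hz⟩
    continuous_smul := fun g ↦
      ((continuous_const_smul g).comp continuous_subtype_val).subtype_mk _
    proj_smul := fun g z ↦ Subtype.ext (apply_smul q horb g z)
    exists_smul_of_proj_eq := fun {e e'} h ↦ by
      obtain ⟨g, hg⟩ := (horb e e').1 (congrArg Subtype.val h).symm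
      exact ⟨g, Subtype.ext hg.symm⟩ }

/-- The projection of `freeCover` is the restriction of `q`. [cite: HatcherAT2002, §1.3 Prop. 1.40] -/
theorem freeCover_proj [Fintype G] (O : Set Y) (hO : ∀ z : Z, q z ∈ O → ∀ g : G, g • z = z → g = 1) :
    (letI := preimageMulAction q horb O; (freeCover q horb hsurj O hO).proj) =
      restrictMap q (mapsTo_preimage q O) := rfl

/-- The deck transformations of `freeCover` are the restrictions of the `smulMap g`. [cite: HatcherAT2002, §1.3 Prop. 1.40] -/
theorem freeCover_deck [Fintype G] (O : Set Y) (hO : ∀ z : Z, q z ∈ O → ∀ g : G, g • z = z → g = 1)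
    (g : G) :
    (letI := preimageMulAction q horb O; (freeCover q horb hsurj O hO).deck g) =
      restrictMap (smulMap g) (mapsTo_smul q horb g O) :=
  ContinuousMap.ext fun _ ↦ rfl

variable [CharZero R] [Fintype G]

include horb hsurj in
/-- **Free case, injectivity in the subset model**: for `O ⊆ Y` over which the action is free,
`q^* : H^p_Y(O) → H^p_Z(q⁻¹O)` is injective (`FiniteDeckCover.map_proj_injective`, transported
along `H^p_X(W) ≅ H^p(↥W)`). [cite: HatcherAT2002, §3.G Prop. 3G.1] [cite: Bredon1997, II Thm. 19.2] -/
theorem qH_injective_of_free (O : Set Y) (hO : ∀ z : Z, q z ∈ O → ∀ g : G, g • z = z → g = 1)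
    (p : ℕ) : Function.Injective (qH (R := R) q O p) := by
  letI := preimageMulAction q horb O
  have hc := (freeCover q horb hsurj O hO).map_proj_injective (R := R) p
  have hV := ((forget (ModuleCat R)).mapIso (homologyIsoSingularCohomology R O p)).toEquiv.injective
  intro y y' hyy'
  have h1 := congrArg (homologyIsoSingularCohomology R (q ⁻¹' O) p).hom hyy'
  have e := homologyIsoSingularCohomology_hom_pullH (R := R) q (mapsTo_preimage q O) p
  erw [e y, e y'] at h1
  exact hV (hc h1)

include horb hsurj in
/-- **Free case, invariants in the subset model**: for `O ⊆ Y` over which the action is free,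
every `G`-invariant class of `H^p_Z(q⁻¹O)` is `q^*` of a class of `H^p_Y(O)`
(`FiniteDeckCover.mem_range_map_proj_of_invariant`, transported).
[cite: HatcherAT2002, §3.G Prop. 3G.1] [cite: Bredon1997, II Thm. 19.2] -/
theorem exists_qH_eq_of_free (O : Set Y) (hO : ∀ z : Z, q z ∈ O → ∀ g : G, g • z = z → g = 1)
    (p : ℕ) (x : (subsetCochains R (SimplexSpan.coefR R) (q ⁻¹' O)).homology p)
    (hx : ∀ g : G, act q horb O g p x = x) : ∃ y, qH (R := R) q O p y = x := by
  letI := preimageMulAction q horb O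
  have eact : ∀ g : G, (homologyIsoSingularCohomology R (q ⁻¹' O) p).hom (act q horb O g p x) =
      singularCohomology.map R R (restrictMap (smulMap g) (mapsTo_smul q horb g O)) p
        ((homologyIsoSingularCohomology R (q ⁻¹' O) p).hom x) :=
    fun g ↦ homologyIsoSingularCohomology_hom_pullH (R := R) (smulMap g) (mapsTo_smul q horb g O) p x
  have hx' : ∀ g : G, singularCohomology.map R R ((freeCover q horb hsurj O hO).deck g) p
      ((homologyIsoSingularCohomology R (q ⁻¹' O) p).hom x) =
        (homologyIsoSingularCohomology R (q ⁻¹' O) p).hom x := by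
    intro g
    rw [freeCover_deck q horb hsurj O hO g, ← eact g, hx g]
  obtain ⟨y', hy'⟩ := (freeCover q horb hsurj O hO).mem_range_map_proj_of_invariant (R := R) p _ hx'
  refine ⟨(homologyIsoSingularCohomology R O p).inv y', ?_⟩
  apply ((forget (ModuleCat R)).mapIso (homologyIsoSingularCohomology R (q ⁻¹' O) p)).toEquiv.injective
  have e := homologyIsoSingularCohomology_hom_pullH (R := R) q (mapsTo_preimage q O) p
    ((homologyIsoSingularCohomology R O p).inv y')
  change (homologyIsoSingularCohomology R (q ⁻¹' O) p).hom (pullH q (mapsTo_preimage q O) p _) = _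
  rw [e, Iso.inv_hom_id_apply, ← freeCover_proj q horb hsurj O hO]
  exact hy'

end Free

end OrbitMap

end Literature.AlgebraicTopology.SingularHomology
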